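import Literature.MathematicalPhysics.QuantumFieldTheory.Balaban1983to89.B9Eq324PenaltyBlockLocal
import Literature.MathematicalPhysics.QuantumFieldTheory.Balaban1983to89.B9Eq360Vprime

/-!
# `Balaban1983to89.B9Eq357QprimeTowerKernelForm` — T. Bałaban, *Propagators for lattice gauge theories in a background field*, Commun. Math. Phys.
# **99** (1985) 389–434 [Balaban1985BackgroundPropagators] (3.19) p. 393, (3.57)–(3.59) pp. 401–402: **THE COMPOSITE SITE AVERAGING `Q′_k(U)` OF THE
# NE9 CHAIN IS A BLOCK-LOCAL KERNEL OPERATOR OF THE SECT. B PROGRAMME's SHAPE** — `(Q′_k(U)λ)(y) = Σ_{x ∈ B^k(y)} k_Q(y, x)λ(x)` with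
# `k_Q(y, x) = (Q′_k(U)δ_x)(y)`, `‖k_Q(y, x)‖ ≤ L^{−kd}`, `|B^k(y)|·L^{−kd} = 1`, `k_Q(y, x) = 0` off the block; `Q′_k(U) = Q′_k(1) + F′_{2,k}` with
# `k_F := k_Q(U) − k_Q(1)` and the (3.58)-shaped letter `‖k_F(y, x)‖ ≤ (Π_{j<k}(1 + ε_j)^{d(L−1)} − 1)·L^{−kd}`; read on the Sect. B programme's carrier
# (`𝔸`-valued site functions along the fibre identification `φ`) it IS `B9Eq360Vprime.kerOp blk k_Q` — junction item (j3-b) of the NE9 lineage's route memo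
# `ROUTE-J-VIA-THM34-g98.md` (the averaging half of the instantiation of the Sect. B programme `B9Thm34GpKernelUniform` ∕ `B9Eq365RemainderKernelUniform` at the
# chain's objects)

statement-level skeleton of published theorems with citation tags; proofs where landed; nothing here is a claim about the Yang–Mills mass gap

CITATION HEADER (lean-in-tree rule).  Audit cell `pub-balaban`, sub-cell `t4`, BINDER row NE9; NE9 crux-team LEAF PROVER 01 (`b2b-balaban-t4-ne9-formalise-leaf-01`,
gen 99; bears_on: R4/N22).  Vocabulary BY NAME: `B9Eq315QTower.QprimeTower` ∕ `towerP` (the composite (3.19), finest factor first), `B9Eq319QprimeTorus.QprimeLin` ∕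
`Qprime` ∕ `stepTransport` ∕ `weight` ∕ `contour` ∕ `blockOf`, `B9Eq323Ker.pathTr` ∕ `avgQ`, `B9Eq326OperatorTower.QprimeTowerW` (the chain's `Q′_{n+1}(U)` on the `L²`
carrier), `B9Eq310HessianOperator.adTransportW` ∕ `B9Eq33CovDerivVector.adTransport` (the transporters `R(Ū^j(b))` on the fibre `W` ∕ on `𝔸`), `B9Eq315QTower.UlevOf`,
`B9Eq324PenaltyBlockLocal.QprimeTower_apply_eq_of_eqOn_fibre` ∕ `card_fibre_eq`, `B9Eq319QprimeContraction.sum_norm_QprimeTower_le`,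
`B9Eq319QprimeTowerBlockLocal.norm_QprimeTower_sub_flat_apply_le_local`, `B9Eq316TowerFlatIsOneStep.QprimeTower_flat_apply`, and the Sect. B programme's
`B9Eq360Vprime.kerOp` ∕ `block` (cell `lit-balaban`, seat r06).  Source read in the held text `paper:balaban1985-cmp99-background-propagators` (journal page = PDF
page + 388) through the verbatim quotations of those files: p. 393 (3.19) «(Q′_j(U)λ)(y) = Σ_{x∈B^j(y)} L^{−jd}R(U(Γ^{(j)}_{y,x}))λ(x)», p. 401 (3.57), p. 402
(3.58)–(3.59) «hence finally (Q′_j(U′U)λ)(y) = (Q′_j(U)λ)(y) + (F′_{2,j}(A)λ)(y), (F′_{2,j}(A)λ)(y) = Σ_{x∈Bʲ(y)} L^{−jd}F′_{2,j}(A; y, x)λ(x), and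
|(F′_{2,j}(A)λ)(y)| ≦ O(1)α₁(Q′_j|λ|)(y)».  [folklore] algebra between two encodings of the same printed operator; NOTHING of print's estimates is asserted.

WHAT IS PROVED (sorry-free; three `def`s with bodies — the `k`-level block map, the kernel of the composite, its continuous `ℝ`-linear reading — and theorems).
* §1 `blkK L m n x = (x_i ∕ L^{n+1})_i` (the `k = n+1`-level block coordinate `T_{L^{n+1}m} → T_m`), `blkK_eq_iff` (= the tree's fibre predicate
  `∀ i, x_i ∕ L^{n+1} = y_i`), `block_blkK_eq_filter` (r06's `block blkK y` = the tree's fibre filter), `card_block_blkK` (`= (L^d)^{n+1}`),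
  `card_block_blkK_mul_inv_eq_one` (`|B^k(y)|·L^{−kd} = 1` — r06's `hcard` with equality).
* §2 NATURALITY of (3.19) under a fibre map: `pathTr_map`, `stepTransport_map`, `QprimeLin_map`, **`QprimeTower_map`** (`ψ((Q′_n(R)l)(y)) = (Q′_n(R′)(ψ∘l))(y)`
  whenever `ψ ∘ R_j(b) = R′_j(b) ∘ ψ`); **`phi_QprimeTowerW_apply`** — the chain's `Q′_{n+1}(U)` read in `𝔸` along `φ` IS `QprimeTower` at the transporters
  `adTransport (Ū^j)` on `𝔸`-valued functions (`φ ∘ adTransportW φ V b = adTransport V b ∘ φ`).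
* §3 THE KERNEL: `kerQT L m R n y x := (Q′_n(R)(δ_x ·))(y)` (`ℂ`-linear); **`QprimeTower_apply_eq_sum_kerQT`** (`(Q′_n(R)l)(y) = Σ_x k(y,x)(l x)`),
  `kerQT_eq_zero_of_not_over` (support in the fibre), **`QprimeTower_apply_eq_sum_filter_kerQT`**, **`norm_kerQT_apply_le`** (`‖k(y,x)v‖ ≤ (L^n)^{−d}‖v‖` for
  contractive transporters), `kerQT_flat_apply` (`k_{Q′(1)}(y,x)v = (L^n)^{−d}·v` on the fibre).
* §4 ON THE SECT. B PROGRAMME's CARRIER (`[FiniteDimensional ℂ V]`): `kQ L m n R y x : V →L[ℝ] V` (the same kernel, `ℝ`-linear and continuous), `kQ_apply`,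
  **`kerOp_blkK_kQ_apply`** ∕ **`kerOp_blkK_kQ_eq`** (`kerOp blkK kQ = Q′_{n+1}(R)` as maps), **`norm_kQ_le`** (r06's `hkQ` with `w ≡ (L^{n+1})^{−d}`), `kQ_eq_zero_of_ne`,
  **`phi_QprimeTowerW_eq_kerOp`** (the chain's `Q′_{n+1}(U)λ`, read in `𝔸`, is `kerOp blkK (kQ … (adTransport Ū^·)) (φ ∘ λ)`).
* §5 (3.57)–(3.59): `kerOp_add_kernel` (`kerOp (k + k′) = kerOp k + kerOp k′`), **`QprimeTower_eq_flat_add_kerOp_kF`** (`Q′_{n+1}(R) = Q′_{n+1}(1) + F′₂` with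
  `F′₂ = kerOp blkK (kQ(R) − kQ(1))`), **`norm_kF_le`** (the (3.58)-shaped letter `‖(kQ(R) − kQ(1))(y,x)‖ ≤ (Π_{j≤n}(1 + ε_j)^{d(L−1)} − 1)·(L^{n+1})^{−d}` from the level
  profile `ε_j` of the transporters over the block — `B9Eq319QprimeTowerBlockLocal` at `δ_x`).
HONEST SCOPE.  Bookkeeping: the composite averaging of the chain in the kernel ∕ block vocabulary of the Sect. B programme, with the (3.19) weight letter and the
(3.58) SHAPE (the profile `ε_j` is DISPLAYED; its discharge from print's class is `B9Eq315QTowerLipschitzProfile` ∕ the plaquette windows, not here); NOT the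
adjoint side `Q′*` (`liftOp`), NOT the penalty ∕ `Δ′_a` identity, NOT the realification `conj b` — later items (j2)∕(j3); no estimate of the paper; NE9 NOT
PRINTED ∕ NOT PROVED; spine PROVED 0∕9; rung (B)+1 finite T⁴ — NOT infinite volume, NOT mass gap, NOT BetaPertH, NOT Clay.  HONEST DEPENDENCY: continuum YM on T⁴ ⇐
BetaPertH ∧ nine spine estimates (0/9 proved); BetaPertH ⇐ (D1) ∧ (D4) ∧ CAP+tail; G-an2-4 gates asym, D1 and NE2/3/4.  NEW file; nothing modified.  RELATED, NOT
DUPLICATED: `B9Eq357Levels` ∕ `B9Eq358KeyEstimate` (p06: (3.55)–(3.58) on the `ℤ^d` carrier with explicit contours — a different carrier; the size (3.58) is proved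
there, only its SHAPE is displayed here), `B9Eq324PenaltyBlockLocal` (block support of `Q′_k(U)δ_x`, USED), `B9Eq319QprimeContraction` (USED).  Net new unproved facts: 0.
-/

noncomputable section

open scoped BigOperators

namespace Literature.MathematicalPhysics.QuantumFieldTheory.Balaban1983to89.B9Eq357QprimeTowerKernelForm

open B4Sect5Torus (TSite)
open B9SectCLatticeCarrier (Bond shift)
open B9Eq323Ker (pathTr avgQ pathTr_cons_cons)
open B9Eq319QprimeTorus (fineP blockCoord blockOf mem_blockOf_iff Qprime QprimeLin QprimeLin_apply stepTransport weight contour centre)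
open B9Eq315QTower (towerP QprimeTower QprimeTower_zero QprimeTower_succ UlevOf)
open B9Eq316TowerFlatIsOneStep (QprimeTower_flat_apply)
open B9Eq319QprimeContraction (sum_norm_QprimeTower_le)
open B9Eq319QprimeTowerBlockLocal (norm_QprimeTower_sub_flat_apply_le_local)
open B9Eq324PenaltyBlockLocal (QprimeTower_apply_eq_of_eqOn_fibre card_fibre_eq)
open B9Eq311L2Pairing (WL2)
open B11Eq103H1Complex (SiteL2K)
open B9Eq310HessianOperator (adTransportW adTransportW_apply)
open B9Eq33CovDerivVector (adTransport adTransport_apply)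
open B9Eq326OperatorTower (QprimeTowerW)
open B9Eq360Vprime (kerOp kerOp_apply mem_block)

variable {d : ℕ} (L : ℕ) [NeZero L] (m : Fin d → ℕ)

/-! ## §1 The `k = n+1`-level block map `T_{L^{n+1}m} → T_m` and r06's `block` -/

section Block

variable (n : ℕ)

/-- **The `k = n+1`-level block coordinate** `x ↦ (x_i ∕ L^{n+1})_i : T_{L^{n+1}m} → T_m` — the unique unit-lattice site `y` with `x ∈ B^k(y)` ((3.19): the
big blocks `B^j(y)` of the composite averaging). [cite: Balaban1985BackgroundPropagators, (3.19) p.393; Balaban1985Averaging, (2) p.17] -/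
def blkK (x : TSite d (towerP L m (n + 1))) : TSite d m :=
  fun i => ⟨(x i : ℕ) / L ^ (n + 1),
    Nat.div_lt_of_lt_mul (lt_of_lt_of_eq (x i).isLt (B9Eq315QTower.towerP_apply L m (n + 1) i))⟩

omit [NeZero L] in
/-- The block coordinate's value. [cite: Balaban1985Averaging, (2) p.17] -/
@[simp] theorem blkK_apply_val (x : TSite d (towerP L m (n + 1))) (i : Fin d) : ((blkK L m n x i : ℕ)) = (x i : ℕ) / L ^ (n + 1) := rfl

omit [NeZero L] in
/-- `blkK x = y` IS the tree's fibre predicate `∀ i, x_i ∕ L^{n+1} = y_i`. [cite: Balaban1985Averaging, (2) p.17] -/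
theorem blkK_eq_iff (x : TSite d (towerP L m (n + 1))) (y : TSite d m) : blkK L m n x = y ↔ ∀ i, (x i : ℕ) / L ^ (n + 1) = (y i : ℕ) := by
  constructor
  · intro h i
    rw [← h, blkK_apply_val]
  · intro h
    funext i
    exact Fin.ext (h i)

omit [NeZero L] in
/-- r06's `block blkK y` is the tree's fibre filter `{x : x_i ∕ L^{n+1} = y_i}`. [cite: Balaban1985BackgroundPropagators, (3.19) p.393] -/
theorem block_blkK_eq_filter (y : TSite d m) :
    B9Eq360Vprime.block (blkK L m n) y = Finset.univ.filter (fun x : TSite d (towerP L m (n + 1)) => ∀ i, (x i : ℕ) / L ^ (n + 1) = (y i : ℕ)) := by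
  ext x
  rw [mem_block, Finset.mem_filter, blkK_eq_iff]
  simp

/-- **`|B^k(y)| = (L^d)^{n+1}`.** [cite: Balaban1985BackgroundPropagators, (3.15)∕(3.19) p.393; Balaban1985Averaging, (2)–(4) pp.17–18] -/
theorem card_block_blkK [∀ i, NeZero (m i)] (y : TSite d m) : ((B9Eq360Vprime.block (blkK L m n) y).card : ℝ) = ((L : ℝ) ^ d) ^ (n + 1) := by
  rw [block_blkK_eq_filter, card_fibre_eq]

/-- **`|B^k(y)|·L^{−kd} = 1`** — r06's `hcard` (`|B(y)|·w(y) ≤ 1`) with equality at the (3.19) weight `w ≡ (L^{n+1})^{−d}`.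
[cite: Balaban1985BackgroundPropagators, (3.19) p.393] -/
theorem card_block_blkK_mul_inv_eq_one [∀ i, NeZero (m i)] (y : TSite d m) :
    ((B9Eq360Vprime.block (blkK L m n) y).card : ℝ) * (((L : ℝ) ^ (n + 1)) ^ d)⁻¹ = 1 := by
  rw [card_block_blkK, ← pow_mul, ← pow_mul, mul_comm d (n + 1)]
  exact mul_inv_cancel₀ (pow_ne_zero _ (by exact_mod_cast NeZero.ne L))

end Block

/-! ## §2 Naturality of (3.19) and of its composite under a fibre map -/

section Naturality

variable {V V' : Type*} [AddCommGroup V] [Module ℂ V] [AddCommGroup V'] [Module ℂ V']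

omit [NeZero L] in
/-- Transport along a path commutes with a fibre map intertwining the bond transporters. [folklore] [cite: Balaban1985BackgroundPropagators, (3.19) p.393] -/
theorem pathTr_map {X : Type*} (τ : X → X → V →ₗ[ℝ] V) (τ' : X → X → V' →ₗ[ℝ] V') (ψ : V →ₗ[ℝ] V')
    (h : ∀ a b v, ψ (τ a b v) = τ' a b (ψ v)) : ∀ (p : List X) (v : V), ψ (pathTr τ p v) = pathTr τ' p (ψ v)
  | [], v => rfl
  | [_], v => rfl
  | a :: b :: rest, v => by
    rw [pathTr_cons_cons, pathTr_cons_cons, LinearMap.comp_apply, LinearMap.comp_apply, h, pathTr_map τ τ' ψ h (b :: rest) v]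

omit [NeZero L] in
/-- The one-step transporters `stepTransport` commute with an intertwining fibre map. [cite: Balaban1985BackgroundPropagators, (3.19) p.393] -/
theorem stepTransport_map (P : Fin d → ℕ) (Rb : Bond d (fineP L P) → V →ₗ[ℂ] V) (Rb' : Bond d (fineP L P) → V' →ₗ[ℂ] V') (ψ : V →ₗ[ℂ] V')
    (h : ∀ b v, ψ (Rb b v) = Rb' b (ψ v)) (a a' : TSite d (fineP L P)) (v : V) :
    ψ (stepTransport L P (fun b => (Rb b).restrictScalars ℝ) a a' v) = stepTransport L P (fun b => (Rb' b).restrictScalars ℝ) a a' (ψ v) := by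
  unfold stepTransport
  split_ifs with hh
  · exact h _ v
  · rfl

/-- **Naturality of (3.19)**: `ψ((Q′(R)l)(y)) = (Q′(R′)(ψ ∘ l))(y)` for a `ℂ`-linear fibre map with `ψ ∘ R(b) = R′(b) ∘ ψ`.
[cite: Balaban1985BackgroundPropagators, (3.19) p.393] -/
theorem QprimeLin_map (P : Fin d → ℕ) (Rb : Bond d (fineP L P) → V →ₗ[ℂ] V) (Rb' : Bond d (fineP L P) → V' →ₗ[ℂ] V') (ψ : V →ₗ[ℂ] V')
    (h : ∀ b v, ψ (Rb b v) = Rb' b (ψ v)) (l : TSite d (fineP L P) → V) (y : TSite d P) :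
    ψ (QprimeLin L P Rb l y) = QprimeLin L P Rb' (fun x => ψ (l x)) y := by
  rw [QprimeLin_apply, QprimeLin_apply, Qprime, Qprime, avgQ, avgQ, map_sum]
  refine Finset.sum_congr rfl fun x _ => ?_
  rw [LinearMap.map_smul_of_tower]
  congr 1
  exact pathTr_map _ _ (ψ.restrictScalars ℝ) (fun a b v => stepTransport_map L P Rb Rb' ψ h a b v) _ _

/-- **Naturality of the composite**: `ψ((Q′_n(R)l)(y)) = (Q′_n(R′)(ψ ∘ l))(y)` whenever `ψ ∘ R_j(b) = R′_j(b) ∘ ψ` for every level `j`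
(induction on `QprimeTower_succ`). [cite: Balaban1985BackgroundPropagators, (3.19) p.393, (3.15) p.393] -/
theorem QprimeTower_map (Rlev : (j : ℕ) → Bond d (towerP L m (j + 1)) → V →ₗ[ℂ] V) (Rlev' : (j : ℕ) → Bond d (towerP L m (j + 1)) → V' →ₗ[ℂ] V')
    (ψ : V →ₗ[ℂ] V') (h : ∀ j b v, ψ (Rlev j b v) = Rlev' j b (ψ v)) :
    ∀ (n : ℕ) (l : TSite d (towerP L m n) → V) (y : TSite d m), ψ (QprimeTower L m Rlev n l y) = QprimeTower L m Rlev' n (fun x => ψ (l x)) y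
  | 0, l, y => rfl
  | n + 1, l, y => by
    have e1 : QprimeTower L m Rlev (n + 1) l y = QprimeTower L m Rlev n (QprimeLin L (towerP L m n) (Rlev n) l) y := rfl
    have e2 : QprimeTower L m Rlev' (n + 1) (fun x => ψ (l x)) y =
        QprimeTower L m Rlev' n (QprimeLin L (towerP L m n) (Rlev' n) (fun x => ψ (l x))) y := rfl
    have e3 : (fun z => ψ (QprimeLin L (towerP L m n) (Rlev n) l z)) = QprimeLin L (towerP L m n) (Rlev' n) (fun x => ψ (l x)) :=
      funext fun z => QprimeLin_map L (towerP L m n) (Rlev n) (Rlev' n) ψ (h n) l z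
    rw [e1, e2, QprimeTower_map Rlev Rlev' ψ h n, e3]

variable {𝔸 : Type*} [NormedRing 𝔸] [NormedAlgebra ℂ 𝔸] [CompleteSpace 𝔸] {W : Type*} [NormedAddCommGroup W] [InnerProductSpace ℂ W]
  (φ : W ≃ₗ[ℂ] 𝔸) {c₀ : ℝ}

omit [NeZero L] [CompleteSpace 𝔸] in
/-- `φ ∘ R_W(V)(b) = R(V(b)) ∘ φ` — the fibre transporter read in `𝔸` is the conjugation `adTransport`. [cite: Balaban1985BackgroundPropagators, p.390] -/
theorem phi_adTransportW_eq_adTransport {P : Fin d → ℕ} (Vc : Bond d P → 𝔸ˣ) (b : Bond d P) (w : W) :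
    φ (adTransportW φ Vc b w) = adTransport (𝕜 := ℂ) Vc b (φ w) := by
  rw [adTransportW_apply, LinearEquiv.apply_symm_apply, adTransport_apply]

variable [∀ i, NeZero (m i)] (n : ℕ) (U : Bond d (towerP L m (n + 1)) → 𝔸ˣ)

/-- **THE CHAIN's `Q′_{n+1}(U)` READ IN `𝔸`**: `φ((Q′_{n+1}(U)λ)(y)) = (Q′_{n+1}(R(Ū^·))(φ ∘ λ))(y)` — `B9Eq326OperatorTower.QprimeTowerW` along `φ` IS the composite
`QprimeTower` at the conjugations `adTransport (Ū^j)` of `𝔸`-valued site functions (the Sect. B programme's reading of (3.19)).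
[cite: Balaban1985BackgroundPropagators, (3.19) p.393] -/
theorem phi_QprimeTowerW_apply (lam : SiteL2K ℂ d (towerP L m (n + 1)) c₀ W) (y : TSite d m) :
    φ (QprimeTowerW L m n φ U (c₀ := c₀) lam y) =
      QprimeTower L m (fun j => adTransport (𝕜 := ℂ) (UlevOf L m (n + 1) U j)) (n + 1)
        (fun x => φ (WL2.equiv ℂ (fun _ : TSite d (towerP L m (n + 1)) => c₀) W lam x)) y :=
  QprimeTower_map L m (fun j => adTransportW φ (UlevOf L m (n + 1) U j)) (fun j => adTransport (𝕜 := ℂ) (UlevOf L m (n + 1) U j)) φ.toLinearMap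
    (fun _ b v => phi_adTransportW_eq_adTransport φ _ b v) (n + 1) _ y

end Naturality

/-! ## §3 The kernel `k(y, x) = (Q′_n(R)δ_x)(y)` of the composite -/

section Kernel

variable {V : Type*} [AddCommGroup V] [Module ℂ V] (Rlev : (j : ℕ) → Bond d (towerP L m (j + 1)) → V →ₗ[ℂ] V) (n : ℕ)

/-- **The kernel of the composite averaging**: `kerQT L m R n y x = (v ↦ (Q′_n(R)(δ_x v))(y))` — print's `L^{−jd}R(U(Γ^{(j)}_{y,x}))` of (3.19) as the
`ℂ`-linear map it is (NOT re-derived as a contour product: defined through the tree's composite at the point mass `δ_x`).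
[cite: Balaban1985BackgroundPropagators, (3.19) p.393, (3.57) p.401] -/
def kerQT (y : TSite d m) (x : TSite d (towerP L m n)) : V →ₗ[ℂ] V :=
  LinearMap.proj y ∘ₗ QprimeTower L m Rlev n ∘ₗ LinearMap.single ℂ (fun _ : TSite d (towerP L m n) => V) x

/-- Unfolding the kernel. [cite: Balaban1985BackgroundPropagators, (3.19) p.393] -/
theorem kerQT_apply (y : TSite d m) (x : TSite d (towerP L m n)) (v : V) :
    kerQT L m Rlev n y x v = QprimeTower L m Rlev n (Pi.single x v) y := rfl

/-- **`(Q′_n(R)l)(y) = Σ_x k(y, x)(l x)`** (linearity and `l = Σ_x δ_x(l x)`). [cite: Balaban1985BackgroundPropagators, (3.19) p.393] -/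
theorem QprimeTower_apply_eq_sum_kerQT (l : TSite d (towerP L m n) → V) (y : TSite d m) :
    QprimeTower L m Rlev n l y = ∑ x, kerQT L m Rlev n y x (l x) := by
  conv_lhs => rw [← Finset.univ_sum_single l]
  rw [map_sum, Finset.sum_apply]
  rfl

/-- **Support**: `k(y, x) = 0` unless `x` lies over `y` (`B9Eq324PenaltyBlockLocal.QprimeTower_apply_eq_of_eqOn_fibre` at `δ_x`).
[cite: Balaban1985BackgroundPropagators, (3.19) p.393] -/
theorem kerQT_eq_zero_of_not_over {y : TSite d m} {x : TSite d (towerP L m n)} (hx : ¬ ∀ i, (x i : ℕ) / L ^ n = (y i : ℕ)) :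
    kerQT L m Rlev n y x = 0 := by
  apply LinearMap.ext
  intro v
  rw [kerQT_apply, LinearMap.zero_apply, QprimeTower_apply_eq_of_eqOn_fibre L m Rlev n (Pi.single x v) 0 y, map_zero, Pi.zero_apply]
  intro x' hx'
  rw [Pi.zero_apply, Pi.single_eq_of_ne]
  rintro rfl
  exact hx hx'

/-- **`(Q′_n(R)l)(y) = Σ_{x over y} k(y, x)(l x)`** — (3.19) as a block-local kernel sum. [cite: Balaban1985BackgroundPropagators, (3.19) p.393] -/
theorem QprimeTower_apply_eq_sum_filter_kerQT (l : TSite d (towerP L m n) → V) (y : TSite d m) :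
    QprimeTower L m Rlev n l y =
      ∑ x ∈ Finset.univ.filter (fun x : TSite d (towerP L m n) => ∀ i, (x i : ℕ) / L ^ n = (y i : ℕ)), kerQT L m Rlev n y x (l x) := by
  rw [QprimeTower_apply_eq_sum_kerQT, ← Finset.sum_filter_add_sum_filter_not Finset.univ
    (fun x : TSite d (towerP L m n) => ∀ i, (x i : ℕ) / L ^ n = (y i : ℕ))]
  conv_rhs => rw [← add_zero (∑ x ∈ _, _)]
  congr 1
  refine Finset.sum_eq_zero fun x hx => ?_
  rw [Finset.mem_filter] at hx
  rw [kerQT_eq_zero_of_not_over L m Rlev n hx.2, LinearMap.zero_apply]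

/-- At the FLAT background the kernel is the constant weight on the fibre: `k_{Q′_n(1)}(y, x)v = (L^n)^{−d}·v` for `x` over `y`.
[cite: Balaban1984PropagatorsI, (1.16)–(1.18) p.20; Balaban1985BackgroundPropagators, (3.19) p.393] -/
theorem kerQT_flat_apply {y : TSite d m} {x : TSite d (towerP L m n)} (hx : ∀ i, (x i : ℕ) / L ^ n = (y i : ℕ)) (v : V) :
    kerQT L m (fun _ _ => (LinearMap.id : V →ₗ[ℂ] V)) n y x v = (((L : ℝ) ^ n) ^ d)⁻¹ • v := by
  rw [kerQT_apply, QprimeTower_flat_apply, Finset.sum_eq_single x]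
  · rw [Pi.single_eq_same]
  · intro x' _ hx'
    rw [Pi.single_eq_of_ne hx', smul_zero]
  · intro hx'
    exact absurd (Finset.mem_filter.2 ⟨Finset.mem_univ _, hx⟩) hx'

end Kernel

section KernelNorm

variable {V : Type*} [NormedAddCommGroup V] [NormedSpace ℂ V] (Rlev : (j : ℕ) → Bond d (towerP L m (j + 1)) → V →ₗ[ℂ] V)
  (hR : ∀ j b v, ‖Rlev j b v‖ ≤ ‖v‖) (n : ℕ)
include hR

/-- **THE (3.19) WEIGHT LETTER: `‖k(y, x)v‖ ≤ (L^n)^{−d}·‖v‖`** for contractive transporters (`B9Eq319QprimeContraction.sum_norm_QprimeTower_le` at `δ_x`: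
the single entry is bounded by the `ℓ¹` sum). [cite: Balaban1985BackgroundPropagators, (3.19) p.393] -/
theorem norm_kerQT_apply_le (y : TSite d m) (x : TSite d (towerP L m n)) (v : V) :
    ‖kerQT L m Rlev n y x v‖ ≤ (((L : ℝ) ^ n) ^ d)⁻¹ * ‖v‖ := by
  rw [kerQT_apply]
  have h1 : ‖QprimeTower L m Rlev n (Pi.single x v) y‖ ≤ ∑ y', ‖QprimeTower L m Rlev n (Pi.single x v) y'‖ :=
    Finset.single_le_sum (f := fun y' => ‖QprimeTower L m Rlev n (Pi.single x v) y'‖) (fun _ _ => norm_nonneg _) (Finset.mem_univ y)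
  have h2 := sum_norm_QprimeTower_le L m Rlev hR n (Pi.single x v)
  have h3 : ∑ x', ‖(Pi.single x v : TSite d (towerP L m n) → V) x'‖ = ‖v‖ := by
    rw [Finset.sum_eq_single x]
    · rw [Pi.single_eq_same]
    · intro x' _ hx'
      rw [Pi.single_eq_of_ne hx', norm_zero]
    · intro hx
      exact absurd (Finset.mem_univ x) hx
  rw [h3] at h2
  exact h1.trans h2

end KernelNorm

/-! ## §4 On the Sect. B programme's carrier: `kerOp blkK kQ = Q′_{n+1}(R)` -/

section KerOp

variable {V : Type*} [NormedAddCommGroup V] [NormedSpace ℂ V] [FiniteDimensional ℂ V]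
  (n : ℕ) (Rlev : (j : ℕ) → Bond d (towerP L m (j + 1)) → V →ₗ[ℂ] V)

/-- **The kernel of `Q′_{n+1}(R)` as the continuous `ℝ`-linear fibre map `k_Q(y, x) : V →L[ℝ] V`** that r06's `B9Eq360Vprime.kerOp` consumes
(the `ℝ`-structure of `V` restricted from `ℂ`; continuity from finite dimension). [cite: Balaban1985BackgroundPropagators, (3.19) p.393, (3.57) p.401] -/
def kQ (y : TSite d m) (x : TSite d (towerP L m (n + 1))) : V →L[ℝ] V :=
  LinearMap.toContinuousLinearMap ((kerQT L m Rlev (n + 1) y x).restrictScalars ℝ)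

/-- Unfolding `k_Q`. [cite: Balaban1985BackgroundPropagators, (3.19) p.393] -/
theorem kQ_apply (y : TSite d m) (x : TSite d (towerP L m (n + 1))) (v : V) :
    kQ L m n Rlev y x v = QprimeTower L m Rlev (n + 1) (Pi.single x v) y := rfl

/-- `k_Q(y, x) = 0` unless `blkK x = y`. [cite: Balaban1985BackgroundPropagators, (3.19) p.393] -/
theorem kQ_eq_zero_of_ne {y : TSite d m} {x : TSite d (towerP L m (n + 1))} (hx : blkK L m n x ≠ y) : kQ L m n Rlev y x = 0 := by
  rw [Ne, blkK_eq_iff] at hx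
  apply ContinuousLinearMap.ext
  intro v
  rw [kQ_apply, ← kerQT_apply, kerQT_eq_zero_of_not_over L m Rlev (n + 1) hx]
  rfl

/-- **`(kerOp blkK k_Q l)(y) = (Q′_{n+1}(R)l)(y)`** — r06's block-local kernel operator at the chain's kernel IS the composite averaging.
[cite: Balaban1985BackgroundPropagators, (3.19) p.393, (3.57) p.401] -/
theorem kerOp_blkK_kQ_apply (l : TSite d (towerP L m (n + 1)) → V) (y : TSite d m) :
    kerOp (blkK L m n) (kQ L m n Rlev) l y = QprimeTower L m Rlev (n + 1) l y := by
  rw [kerOp_apply, block_blkK_eq_filter, QprimeTower_apply_eq_sum_filter_kerQT]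
  rfl

/-- **`kerOp blkK k_Q = Q′_{n+1}(R)`** as maps of site functions. [cite: Balaban1985BackgroundPropagators, (3.19) p.393, (3.57) p.401] -/
theorem kerOp_blkK_kQ_eq (l : TSite d (towerP L m (n + 1)) → V) :
    kerOp (blkK L m n) (kQ L m n Rlev) l = QprimeTower L m Rlev (n + 1) l :=
  funext fun y => kerOp_blkK_kQ_apply L m n Rlev l y

/-- **r06's `hkQ` AT THE CHAIN's KERNEL: `‖k_Q(y, x)‖ ≤ (L^{n+1})^{−d}`** (for every `y, x`; contractive level transporters) — the (3.19) weight
`w(y) = L^{−jd}`, with `|B(y)|·w(y) = 1` (`card_block_blkK_mul_inv_eq_one`). [cite: Balaban1985BackgroundPropagators, (3.19) p.393] -/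
theorem norm_kQ_le (hR : ∀ j b v, ‖Rlev j b v‖ ≤ ‖v‖) (y : TSite d m) (x : TSite d (towerP L m (n + 1))) :
    ‖kQ L m n Rlev y x‖ ≤ (((L : ℝ) ^ (n + 1)) ^ d)⁻¹ :=
  ContinuousLinearMap.opNorm_le_bound _ (by positivity) fun v => by
    rw [kQ_apply, ← kerQT_apply]
    exact norm_kerQT_apply_le L m Rlev hR (n + 1) y x v

variable {𝔸 : Type*} [NormedRing 𝔸] [NormedAlgebra ℂ 𝔸] [CompleteSpace 𝔸] [FiniteDimensional ℂ 𝔸] {W : Type*} [NormedAddCommGroup W]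
  [InnerProductSpace ℂ W] (φ : W ≃ₗ[ℂ] 𝔸) {c₀ : ℝ} [∀ i, NeZero (m i)] (U : Bond d (towerP L m (n + 1)) → 𝔸ˣ)

/-- **THE CHAIN's `Q′_{n+1}(U)` IS r06's `kerOp`**: read in `𝔸` along `φ`, `(Q′_{n+1}(U)λ)(·) = kerOp blkK (k_Q(R(Ū^·))) (φ ∘ λ)` — junction (j3-b): the
averaging operator of `B9Eq324DeltaPrimeATower.laplacePrimeAk` in the vocabulary of `B9Eq360Vprime` ∕ `B9Thm34GpKernelUniform`.
[cite: Balaban1985BackgroundPropagators, (3.19) p.393, (3.57) p.401, (3.60) p.402] -/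
theorem phi_QprimeTowerW_eq_kerOp (lam : SiteL2K ℂ d (towerP L m (n + 1)) c₀ W) :
    (fun y => φ (QprimeTowerW L m n φ U (c₀ := c₀) lam y)) =
      kerOp (blkK L m n) (kQ L m n (fun j => adTransport (𝕜 := ℂ) (UlevOf L m (n + 1) U j)))
        (fun x => φ (WL2.equiv ℂ (fun _ : TSite d (towerP L m (n + 1)) => c₀) W lam x)) := by
  funext y
  rw [phi_QprimeTowerW_apply, kerOp_blkK_kQ_apply]

omit [CompleteSpace 𝔸] [FiniteDimensional ℂ 𝔸] in
/-- The conjugations `R(V(b))` are contractions of `𝔸` when `‖V(b)‖, ‖V(b)⁻¹‖ ≤ 1` (print: unitary bond variables; the Sect. B programme's `hU1`).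
[cite: Balaban1985BackgroundPropagators, (3.5) p.391] -/
theorem norm_adTransport_le_of_norm_le_one {P : Fin d → ℕ} (Vc : Bond d P → 𝔸ˣ)
    (hV : ∀ b, ‖(Vc b : 𝔸)‖ ≤ 1 ∧ ‖(((Vc b)⁻¹ : 𝔸ˣ) : 𝔸)‖ ≤ 1) (b : Bond d P) (X : 𝔸) : ‖adTransport (𝕜 := ℂ) Vc b X‖ ≤ ‖X‖ := by
  rw [adTransport_apply]
  calc ‖(Vc b : 𝔸) * X * ((Vc b)⁻¹ : 𝔸ˣ)‖ ≤ ‖(Vc b : 𝔸)‖ * ‖X‖ * ‖(((Vc b)⁻¹ : 𝔸ˣ) : 𝔸)‖ :=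
        (norm_mul_le _ _).trans (mul_le_mul_of_nonneg_right (norm_mul_le _ _) (norm_nonneg _))
    _ ≤ 1 * ‖X‖ * 1 := by gcongr <;> [exact (hV b).1; exact (hV b).2]
    _ = ‖X‖ := by rw [one_mul, mul_one]

/-- **r06's `hkQ` FOR THE CHAIN's `Q′_{n+1}(U)` READ IN `𝔸`**: `‖k_Q(R(Ū^·))(y, x)‖ ≤ (L^{n+1})^{−d}` whenever every level background is unit-bounded with
unit-bounded inverses. [cite: Balaban1985BackgroundPropagators, (3.19) p.393, (3.5) p.391] -/
theorem norm_kQ_adTransport_le (hU1 : ∀ j b, ‖(UlevOf L m (n + 1) U j b : 𝔸)‖ ≤ 1 ∧ ‖(((UlevOf L m (n + 1) U j b)⁻¹ : 𝔸ˣ) : 𝔸)‖ ≤ 1)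
    (y : TSite d m) (x : TSite d (towerP L m (n + 1))) :
    ‖kQ L m n (fun j => adTransport (𝕜 := ℂ) (UlevOf L m (n + 1) U j)) y x‖ ≤ (((L : ℝ) ^ (n + 1)) ^ d)⁻¹ :=
  norm_kQ_le L m n _ (fun j b v => norm_adTransport_le_of_norm_le_one _ (hU1 j) b v) y x

end KerOp

/-! ## §5 (3.57)–(3.59): `Q′_{n+1}(R) = Q′_{n+1}(1) + F′₂`, `F′₂ = kerOp blkK k_F`, `k_F = k_Q(R) − k_Q(1)`, and the (3.58)-shaped letter -/

section F2

variable {V : Type*} [NormedAddCommGroup V] [NormedSpace ℂ V] [FiniteDimensional ℂ V]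
  (n : ℕ) (Rlev : (j : ℕ) → Bond d (towerP L m (j + 1)) → V →ₗ[ℂ] V)

omit [NeZero L] in
/-- `kerOp` is additive in the kernel. [folklore] [cite: Balaban1985BackgroundPropagators, (3.59) p.402] -/
theorem kerOp_add_kernel {X S E : Type*} [Fintype X] [DecidableEq S] [NormedAddCommGroup E] [NormedSpace ℝ E] (blk : X → S)
    (k k' : S → X → E →L[ℝ] E) (μ : X → E) : kerOp blk (k + k') μ = kerOp blk k μ + kerOp blk k' μ := by
  funext y
  simp only [kerOp_apply, Pi.add_apply, add_apply, Finset.sum_add_distrib]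

/-- **(3.59) FOR THE CHAIN: `Q′_{n+1}(R)l = Q′_{n+1}(1)l + F′₂ l` with `F′₂ = kerOp blkK (k_Q(R) − k_Q(1))`** — the decomposition the Sect. B programme's (3.60)
consumes (`kQ := k_Q(1)`, `kF := k_Q(R) − k_Q(1)`). [cite: Balaban1985BackgroundPropagators, (3.57) p.401, (3.59) p.402] -/
theorem QprimeTower_eq_flat_add_kerOp_kF (l : TSite d (towerP L m (n + 1)) → V) :
    QprimeTower L m Rlev (n + 1) l =
      QprimeTower L m (fun _ _ => (LinearMap.id : V →ₗ[ℂ] V)) (n + 1) l +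
        kerOp (blkK L m n) (kQ L m n Rlev - kQ L m n (fun _ _ => (LinearMap.id : V →ₗ[ℂ] V))) l := by
  rw [← kerOp_blkK_kQ_eq L m n Rlev, ← kerOp_blkK_kQ_eq L m n (fun _ _ => LinearMap.id), ← kerOp_add_kernel, add_sub_cancel]

/-- The flat kernel on the carrier: `k_Q(1)(y, x)v = (L^{n+1})^{−d}·v` for `blkK x = y` (the plain big-block mean).
[cite: Balaban1984PropagatorsI, (1.18) p.20; Balaban1985BackgroundPropagators, (3.19) p.393] -/
theorem kQ_flat_apply {y : TSite d m} {x : TSite d (towerP L m (n + 1))} (hx : blkK L m n x = y) (v : V) :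
    kQ L m n (fun _ _ => (LinearMap.id : V →ₗ[ℂ] V)) y x v = (((L : ℝ) ^ (n + 1)) ^ d)⁻¹ • v := by
  rw [kQ_apply, ← kerQT_apply, kerQT_flat_apply L m (n + 1) ((blkK_eq_iff L m n x y).1 hx)]

/-- **THE (3.58)-SHAPED LETTER: `‖(k_Q(R) − k_Q(1))(y, x)‖ ≤ (Π_{j≤n}(1 + ε_j)^{d(L−1)} − 1)·(L^{n+1})^{−d}`** whenever, for every level `j ≤ n`, the
transporters of the level-`(j+1)` bonds internal to a level-`j` block and lying over `y` are `ε_j`-close to the identity — r06's `hkF : ‖kF y x‖ ≤ C_q·α₁·w(y)`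
with `C_qα₁ := Π(1+ε_j)^{d(L−1)} − 1` (`B9Eq319QprimeTowerBlockLocal.norm_QprimeTower_sub_flat_apply_le_local` at `δ_x`; print: «|F′_{2,j}(A; y, x)| ≦ O(1)α₁»).
[cite: Balaban1985BackgroundPropagators, (3.58) p.402, (3.19) p.393, (3.35) p.396] -/
theorem norm_kF_le (ε : ℕ → ℝ) (hε : ∀ j, 0 ≤ ε j) (y : TSite d m)
    (hR : ∀ j < n + 1, ∀ (x : TSite d (towerP L m (j + 1))) (μ : Fin d),
        blockCoord L (towerP L m j) x = blockCoord L (towerP L m j) (shift μ x) → (∀ i, (x i : ℕ) / L ^ (j + 1) = (y i : ℕ)) →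
          ∀ v, ‖Rlev j (x, μ) v - v‖ ≤ ε j * ‖v‖)
    (x : TSite d (towerP L m (n + 1))) :
    ‖(kQ L m n Rlev - kQ L m n (fun _ _ => (LinearMap.id : V →ₗ[ℂ] V))) y x‖ ≤
      ((∏ j ∈ Finset.range (n + 1), (1 + ε j) ^ (d * (L - 1))) - 1) * (((L : ℝ) ^ (n + 1)) ^ d)⁻¹ := by
  have hPr : 1 ≤ ∏ j ∈ Finset.range (n + 1), (1 + ε j) ^ (d * (L - 1)) :=
    Finset.one_le_prod (s := Finset.range (n + 1)) fun j _ => one_le_pow₀ (by linarith [hε j])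
  refine ContinuousLinearMap.opNorm_le_bound _ (mul_nonneg (by linarith) (by positivity)) fun v => ?_
  rw [Pi.sub_apply, Pi.sub_apply, sub_apply, kQ_apply, kQ_apply]
  refine (norm_QprimeTower_sub_flat_apply_le_local L m Rlev ε hε y (n + 1) hR (Pi.single x v)).trans ?_
  rw [mul_assoc]
  refine mul_le_mul_of_nonneg_left (mul_le_mul_of_nonneg_left ?_ (by positivity)) (by linarith)
  calc ∑ x' ∈ Finset.univ.filter (fun x' : TSite d (towerP L m (n + 1)) => ∀ i, (x' i : ℕ) / L ^ (n + 1) = (y i : ℕ)),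
        ‖(Pi.single x v : TSite d (towerP L m (n + 1)) → V) x'‖
      ≤ ∑ x', ‖(Pi.single x v : TSite d (towerP L m (n + 1)) → V) x'‖ :=
        Finset.sum_le_sum_of_subset_of_nonneg (Finset.filter_subset _ _) fun _ _ _ => norm_nonneg _
    _ = ‖v‖ := by
        rw [Finset.sum_eq_single x]
        · rw [Pi.single_eq_same]
        · intro x' _ hx'
          rw [Pi.single_eq_of_ne hx', norm_zero]
        · intro hx
          exact absurd (Finset.mem_univ x) hx

end F2

end Literature.MathematicalPhysics.QuantumFieldTheory.Balaban1983to89.B9Eq357QprimeTowerKernelForm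

end
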